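import Summits.ResolutionOfSingularities.ResolutionOfSingularities.Theorems.FrobeniusLadderFInjectiveMacaulayficationBlowupStalkOverAffine
import Summits.ResolutionOfSingularities.ResolutionOfSingularities.Theorems.FrobeniusLadderFInjectiveMacaulayficationReductions
import Literature.AlgebraicGeometry.Resolution.Blowups
import Literature.AlgebraicGeometry.Resolution.BlowupsIntegral
import Literature.AlgebraicGeometry.Resolution.BlowupsProperProofs
import Literature.AlgebraicGeometry.Resolution.AffineBlowup

/-!
# Crux `FInjectiveMacaulayfication`: E7 — the global blow-up glue (line `Sketch`, cycle 6)

Support file for crux `stmt-ResolutionOfSingularities-15315` (`FrobeniusLadder.FInjectiveMacaulayfication`, route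
`ResolutionOfSingularities/FrobeniusLadder`, rung 2), line `Sketch`, registered stub `stub_fiModelOfIsBlowup`
(the lead's assembly of package A).

Every certification engine landed for the open core of the crux so far (E1 deformation, E2 Fedder, E4 degree-zero
descent, E5 localization, E6/E6′ the affine blow-up glue, the calibration `Bl_𝔪 E₈⁰` in characteristic 5) ends at
an AFFINE scheme `Spec R`, while the open core `stub_fInjectivizeIntegral` quantifies over a non-affine integral
`X₁` (Kawasaki's Macaulayfication is projective over `X`, never affine). This file globalizes: for a blow-up
`π : X' → X₁` in the sense of the universal property (`IsBlowup π J`, Görtz–Wedhorn I, Def. 13.90) of a locally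
Noetherian scheme `X₁` along an ideal sheaf `J` with dense co-support, if for the affine opens `U` of some cover of
`X₁` every stalk of the Proj model `affineBlowup (J.ideal U)` satisfies the crux's stalk clause (domain; every
system of parameters weakly regular; parameter ideals Frobenius closed), then `π` is proper
(`IsBlowup.isProper`, Stacks 02NS), birational (`π` is an isomorphism over `X₁ ∖ supp J`, Stacks 02OS, and the
preimage is dense, Stacks 02ND) and every stalk of `X'` satisfies the clause (stalks of `X'` over `U` are stalks
of `affineBlowup (J.ideal U)`, `BlowupStalkOverAffine.stub_blowupStalkOverAffine`, and the clause is invariant under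
ring isomorphisms, `fiClause_of_ringEquiv`).

* `stub_fiModelOfIsBlowup` — the registered form, verbatim.

With E6″ (`stub_affineBlowupStalkClause`: the stalks of `affineBlowup I` satisfy the clause when `R_P` does off
`V(I)` and the chart rings `R[I/xᵢ]` satisfy the Cohen–Macaulay + Frobenius-closed clause at their closed points
on the exceptional divisor) and `stub_clauseOffCentre` (the off-centre hypothesis from the stalks of `X₁`), the
open core is reduced to: ONE global centre `J ≠ ⊥` on the integral Cohen–Macaulay `X₁`, containing the
non-F-injective locus, with certified charts.

References: U. Görtz, T. Wedhorn, *Algebraic Geometry I* (2nd ed. 2020), Def. 13.90, Prop. 13.91, Prop. 13.96;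
The Stacks Project, Tags 02NS, 02OS, 02ND, 0804. [folklore]
-/

-- single-problem summit: the doubled namespace component is forced
set_option linter.dupNamespace false

noncomputable section

namespace Summit.ResolutionOfSingularities.ResolutionOfSingularities.Theorems.FInjectiveMacaulayfication.FiModelOfIsBlowup

open AlgebraicGeometry CategoryTheory Literature.AlgebraicGeometry.Resolution

/-- **E7 THE GLOBAL GLUE** (registered stub `stub_fiModelOfIsBlowup`): let `X₁` be locally Noetherian, `J` an
ideal sheaf whose co-support `X₁ ∖ supp J` is dense, and `π : X' → X₁` a blow-up along `J` (universal property).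
If for the affine opens `U` of some cover `S` of `X₁` every stalk of `affineBlowup (J.ideal U)` satisfies the full
clause, then `π` is proper, birational, and EVERY STALK of `X'` satisfies the full clause.
[cite: GortzWedhorn2020, Prop. 13.91 and Prop. 13.96] -/
theorem stub_fiModelOfIsBlowup : ∀ (p : ℕ) (X₁ X' : Scheme.{0}) [IsLocallyNoetherian X₁]
    (J : X₁.IdealSheafData) (π : X' ⟶ X₁), IsBlowup π J → Dense ((J.support : Set X₁)ᶜ) →
    ∀ (S : Set X₁.affineOpens), (∀ x : X₁, ∃ U ∈ S, x ∈ (U : X₁.Opens)) →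
    (∀ U ∈ S, ∀ y : ↥(affineBlowup (J.ideal U)), IsDomain ((affineBlowup (J.ideal U)).presheaf.stalk y) ∧
      ∀ d : ℕ, ringKrullDim ((affineBlowup (J.ideal U)).presheaf.stalk y) = d →
        ∀ s : Fin d → (affineBlowup (J.ideal U)).presheaf.stalk y,
          (Ideal.span (Set.range s)).radical.IsMaximal →
          RingTheory.Sequence.IsWeaklyRegular ((affineBlowup (J.ideal U)).presheaf.stalk y) (List.ofFn s) ∧
          ∀ z : (affineBlowup (J.ideal U)).presheaf.stalk y, (∃ e : ℕ, z ^ p ^ e ∈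
              Ideal.span ((fun w : (affineBlowup (J.ideal U)).presheaf.stalk y => w ^ p ^ e) ''
                (Ideal.span (Set.range s) : Set ((affineBlowup (J.ideal U)).presheaf.stalk y)))) →
            z ∈ Ideal.span (Set.range s)) →
    IsProper π ∧ Literature.AlgebraicGeometry.Resolution.IsBirational π ∧
      ∀ x : X', IsDomain (X'.presheaf.stalk x) ∧ ∀ d : ℕ, ringKrullDim (X'.presheaf.stalk x) = d →
        ∀ s : Fin d → X'.presheaf.stalk x, (Ideal.span (Set.range s)).radical.IsMaximal →
          RingTheory.Sequence.IsWeaklyRegular (X'.presheaf.stalk x) (List.ofFn s) ∧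
          ∀ z : X'.presheaf.stalk x, (∃ e : ℕ, z ^ p ^ e ∈
              Ideal.span ((fun w : X'.presheaf.stalk x => w ^ p ^ e) ''
                (Ideal.span (Set.range s) : Set (X'.presheaf.stalk x)))) →
            z ∈ Ideal.span (Set.range s) := by
  intro p X₁ X' _ J π hπ hdense S hS hcl
  refine ⟨hπ.isProper, ⟨centreCompl J, hdense, hπ.dense_preimage_compl, hπ.isIso_compl⟩, fun x => ?_⟩
  obtain ⟨U, hUS, hxU⟩ := hS (π.base x)
  obtain ⟨y, ⟨e⟩⟩ := BlowupStalkOverAffine.stub_blowupStalkOverAffine X₁ X' J π hπ U x hxU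
  exact fiClause_of_ringEquiv p e.symm (hcl U hUS y)

/-- **E7 for an integral base** (the form the open core consumes): for `X₁` integral and locally Noetherian and
`J ≠ ⊥`, the co-support is automatically dense (a non-empty open of an irreducible space), so a blow-up along
`J` whose affine models satisfy the clause stalkwise on an affine cover is a proper birational model with the
full clause at every stalk — and its source is integral (`IsBlowup.isIntegral`, Stacks 02ND). [folklore] -/
theorem fiModel_of_isBlowup_of_isIntegral (p : ℕ) {X₁ X' : Scheme.{0}} [IsIntegral X₁] [IsLocallyNoetherian X₁]
    {J : X₁.IdealSheafData} (hJ : J ≠ ⊥) {π : X' ⟶ X₁} (hπ : IsBlowup π J)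
    (S : Set X₁.affineOpens) (hS : ∀ x : X₁, ∃ U ∈ S, x ∈ (U : X₁.Opens))
    (hcl : ∀ U ∈ S, ∀ y : ↥(affineBlowup (J.ideal U)), IsDomain ((affineBlowup (J.ideal U)).presheaf.stalk y) ∧
      ∀ d : ℕ, ringKrullDim ((affineBlowup (J.ideal U)).presheaf.stalk y) = d →
        ∀ s : Fin d → (affineBlowup (J.ideal U)).presheaf.stalk y,
          (Ideal.span (Set.range s)).radical.IsMaximal →
          RingTheory.Sequence.IsWeaklyRegular ((affineBlowup (J.ideal U)).presheaf.stalk y) (List.ofFn s) ∧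
          ∀ z : (affineBlowup (J.ideal U)).presheaf.stalk y, (∃ e : ℕ, z ^ p ^ e ∈
              Ideal.span ((fun w : (affineBlowup (J.ideal U)).presheaf.stalk y => w ^ p ^ e) ''
                (Ideal.span (Set.range s) : Set ((affineBlowup (J.ideal U)).presheaf.stalk y)))) →
            z ∈ Ideal.span (Set.range s)) :
    IsProper π ∧ Literature.AlgebraicGeometry.Resolution.IsBirational π ∧ IsIntegral X' ∧
      ∀ x : X', IsDomain (X'.presheaf.stalk x) ∧ ∀ d : ℕ, ringKrullDim (X'.presheaf.stalk x) = d →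
        ∀ s : Fin d → X'.presheaf.stalk x, (Ideal.span (Set.range s)).radical.IsMaximal →
          RingTheory.Sequence.IsWeaklyRegular (X'.presheaf.stalk x) (List.ofFn s) ∧
          ∀ z : X'.presheaf.stalk x, (∃ e : ℕ, z ^ p ^ e ∈
              Ideal.span ((fun w : X'.presheaf.stalk x => w ^ p ^ e) ''
                (Ideal.span (Set.range s) : Set (X'.presheaf.stalk x)))) →
            z ∈ Ideal.span (Set.range s) := by
  have hdense : Dense ((J.support : Set X₁)ᶜ) :=
    (J.support.isClosed.isOpen_compl).dense (centreCompl_nonempty (J := J) hJ)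
  obtain ⟨hprop, hbir, hcl'⟩ := stub_fiModelOfIsBlowup p X₁ X' J π hπ hdense S hS hcl
  exact ⟨hprop, hbir, hπ.isIntegral hJ, hcl'⟩

end Summit.ResolutionOfSingularities.ResolutionOfSingularities.Theorems.FInjectiveMacaulayfication.FiModelOfIsBlowup

end
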